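import Literature.Computability.AlgebraicComplexity.IK2020TableauLiftingLeftPart
import Literature.Computability.AlgebraicComplexity.IK2020HypergraphCounting
import HarnessLib

/-!
# Ikenmeyer–Kandasamy 2020, Thm. 13.1 (Tableau Lifting Theorem) for even `D`

References: C. Ikenmeyer, U. Kandasamy, "Implementing geometric complexity theory: on the
separation of orbit closures via symmetries", STOC 2020 / arXiv:1911.03990 (bib key
`IkenmeyerKandasamy2019`), Thm. 13.1 (TeX L1128–1144; chunk p0019.txt:L11–26 of the held text
`paper:arxiv-1911.03990`) and its proof for even `D`, §§14–17 (TeX L1238–2400; chunks p0021–p0026):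
§17 opening, "First we observe that the shape of `T` is indeed the required shape … every symbol in
`T` appears exactly `D` many times … It remains to prove the parts (1), (2), and (3)".

Brick E4 (with E2h) of the multi-seat program for the named fact `IK2020_thm_13_1`
(`AC/IK20HighestWeightVectors.lean`; route note `HOME/bip/NOTE-t08g4-IK2020Thm131-route.md`):
the ASSEMBLY of the even-`D` half from bricks E1 (`IK2020TableauLiftingAlphabet`: alphabet,
transport, corner `d = 0`), E2 (`IK2020TableauLiftingLeftPart`: `leftpart(T)`, Claims 23–36), E3
(`IK2020TableauLiftingRightPart`: `rightpart(T)`), t08 g0's hypergraphs (`IK2020Hypergraphs`: Def.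
14.1, the chain construction of Prop. 14.2) and t08 g4's counting (`IK2020HypergraphCounting`:
`IsPartitionBy.part`). Theorem-only apart from nothing: no definition, no named fact; net debt 0.
Honest framing: the even-`D` half of ONE published combinatorial theorem used inside IK's proof of
their Thm. 4.2; the named fact `IK2020_thm_13_1` stays OPEN until the odd-`D` half (§§18–21) is
formalised (`IK2020_thm_13_1_of_odd_case` records exactly what remains); VP ≠ VNP is NOT proved
and nothing here is progress on it.

## Contents

* §A (brick E2h) **the hypergraph data in function form**: from a `(D,K)`-hypergraph structure on
  the chain hypergraph `IK2020.Chain.hyper D b L₁ L₂` (vertex set `Fin b × Fin D`, block edges = rows)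
  we extract the name-edge index `ℓ = ` (an enumeration of) `IsPartitionBy.part`, its fibre sizes,
  connectivity and the link pair (`exists_linkFun_chain`); with the parameters of the proof of
  Prop. 14.2 this gives the data for one letter (`exists_linkFun`), and for all letters a
  `LinkData m D (blockCount D ∘ ϱ) ϱ` (`nonempty_linkData`; §15 first sentence: "For each `i ∈ I` let
  `H^{(i)}` be a `(D, ϱ_i)`-hypergraph from Proposition 14.2").
* §B **assembly**: for any `LinkData` and any enumeration `Fin E ≃ LCol` of the columns, the pair
  (`leftpart`, `rightpart` with quotas `D - n(i_ℓ)`) is a `LiftingWitness` (`exists_liftingWitness`):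
  (count) by Claims 25/26/28 and §16; (1) by Claims 29/30 and §17 "Proof of part (1)"; (2) by
  properties (I)–(III) and "a uniform tableau with an even number of columns is duplex"; (3) by the
  letter map `φ(i_ℓ) = i`, `φ(j_k^i) = j`.
* §C **Thm. 13.1 for even `D`** over the descriptive alphabet (`IK2020_thm_13_1_even`) and over
  `Fin δ` verbatim as in the named fact (`IK2020_thm_13_1_of_even`); and the reduction of the named
  fact to its odd-`D` half (`IK2020_thm_13_1_of_odd_case`).
-/

namespace Literature.Computability.AlgebraicComplexity

namespace IK2020

open Finset

/-! ## §A  The data of the chain hypergraphs in function form (brick E2h) -/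

/-- `⌈K/c⌉ · c` lies between `K` and `K + c - 1` (the estimate in the proof of Prop. 14.2, TeX
L1716–1720: "`(⌈K/(D-2)⌉ (D-2) + 2) - (K+1) ≥ 1 > 0`"). [cite: IkenmeyerKandasamy2019, Prop. 14.2] -/
theorem ceilDiv_mul_ge_and_le (K c : ℕ) (hc : 1 ≤ c) :
    K ≤ ceilDiv K c * c ∧ ceilDiv K c * c ≤ K + (c - 1) := by
  unfold ceilDiv
  exact ⟨by have := Nat.lt_div_mul_add (a := K + (c - 1)) (b := c) (by omega); omega,
    Nat.div_mul_le_self _ _⟩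

/-- **The name-edge index and the link pair of a chain hypergraph.** If the chain hypergraph on
`Fin b × Fin D` (block edges = the rows `{k} × Fin D`) is a `(D,K)`-hypergraph with link vertex `ζ`
(Def. 14.1), then numbering its `b + K` name edges (Def. 14.1 (5)) gives `ℓ : Fin b × Fin D → Fin (b+K)`
with: every fibre of `ℓ` is a name edge, of size in `[1, D-1]` (Def. 14.1 (4)); any two vertices are
joined by a chain of steps inside a block edge or inside a name edge (Def. 14.1 (1)); and there is
`ξ ≠ ζ` in the block edge and the name edge of `ζ` (Def. 14.1 (6)). This is the "additional data"
`ℓ(v)`, `k(v)` attached to `H^{(i)}` in §15 (TeX L1765–1784) and the vertex `ξ^{(i)}` of the proof of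
Claim 29. [cite: IkenmeyerKandasamy2019, §15] -/
theorem exists_linkFun_chain {D b L₁ L₂ K : ℕ} {ζ : Fin b × Fin D}
    (hH : (Chain.hyper D b L₁ L₂).IsDK D K ζ) :
    ∃ (ℓ : Fin b × Fin D → Fin (b + K)) (ξ : Fin b × Fin D),
      (∀ a, 1 ≤ (univ.filter fun v => ℓ v = a).card ∧ (univ.filter fun v => ℓ v = a).card < D) ∧
      (∀ v w, Relation.ReflTransGen (fun v w : Fin b × Fin D => v.1 = w.1 ∨ ℓ v = ℓ w) v w) ∧
      ζ ≠ ξ ∧ ζ.1 = ξ.1 ∧ ℓ ζ = ℓ ξ := by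
  classical
  set H := Chain.hyper D b L₁ L₂ with hHdef
  have hD : 0 < D := lt_of_lt_of_le (by norm_num) hH.two_le
  -- two vertices of a block edge lie in the same row
  have hmemB : ∀ E ∈ H.blocks, ∀ v ∈ E, ∀ w ∈ E, v.1 = w.1 := by
    intro E hE v hv w hw
    have hE' : E ∈ Finset.univ.image (Chain.row D b) := hE
    obtain ⟨j, -, rfl⟩ := Finset.mem_image.mp hE'
    simp only [Chain.row, Finset.mem_filter, Finset.mem_univ, true_and] at hv hw
    rw [hv, hw]
  -- `|E_Block| = b`, `|E_Name| = b + K`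
  have hcardB : H.blocks.card = b := by
    have h := hH.card_eq
    rw [Fintype.card_prod, Fintype.card_fin, Fintype.card_fin] at h
    exact (Nat.eq_of_mul_eq_mul_right hD (by rw [h, mul_comm])).symm
  have hcardN : Fintype.card ↥H.names = b + K := by
    rw [Fintype.card_coe, hH.card_names, hcardB]
  let e : ↥H.names ≃ Fin (b + K) := Fintype.equivFinOfCardEq hcardN
  have np := hH.names_partition
  let ℓ : Fin b × Fin D → Fin (b + K) := fun v => e ⟨np.part v, np.part_mem v⟩
  have hℓeq : ∀ v w, ℓ v = ℓ w ↔ np.part v = np.part w := by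
    intro v w
    simp only [ℓ, e.apply_eq_iff_eq, Subtype.mk.injEq]
  -- the fibre of `ℓ` over `a` is the `a`-th name edge
  have hfib : ∀ a, (univ.filter fun v => ℓ v = a) = (e.symm a).1 := by
    intro a
    ext v
    simp only [Finset.mem_filter, Finset.mem_univ, true_and, ℓ]
    rw [Equiv.apply_eq_iff_eq_symm_apply]
    constructor
    · intro h
      rw [← h]
      exact np.mem_part v
    · intro h
      apply Subtype.ext
      exact (np.eq_part (e.symm a).2 h).symm
  -- the link pair
  obtain ⟨eN, heN, eB, heB, hζN, hζB, h2⟩ := hH.link_mem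
  obtain ⟨ξ, hξ, hne⟩ := Finset.exists_mem_ne (lt_of_lt_of_le one_lt_two h2) ζ
  rw [Finset.mem_inter] at hξ
  refine ⟨ℓ, ξ, fun a => ?_, fun v w => ?_, hne.symm, hmemB eB heB ζ hζB ξ hξ.2, ?_⟩
  · rw [hfib a]
    exact hH.card_name _ (e.symm a).2
  · have hstep : ∀ v w : Fin b × Fin D, H.Adj v w → v.1 = w.1 ∨ ℓ v = ℓ w := by
      rintro v w ⟨E, hE, hv, hw⟩
      unfold Hypergraph.edges at hE
      rcases Finset.mem_union.mp hE with hB | hN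
      · exact Or.inl (hmemB E hB v hv w hw)
      · exact Or.inr ((hℓeq v w).2 (by rw [← np.eq_part hN hv, ← np.eq_part hN hw]))
    exact Relation.ReflTransGen.mono hstep v w (hH.connected v w)
  · exact (hℓeq ζ ξ).2 (by rw [← np.eq_part heN hζN, ← np.eq_part heN hξ.1])

/-- **The data of `H^{(i)}` for one letter** (`K = ϱ_i ≠ 0`, `b` block edges with
`K ≤ b(D-2) ≤ K + D - 3`, e.g. `b = ⌈K/(D-2)⌉`): the chain construction of the proof of Prop. 14.2
(`IK2020.Chain.isDK_hyper`: the link vertex's name edge has size `b(D-2) + 2 - K ∈ [2, D-1]`, all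
other non-bridge vertices are singletons) is a `(D,K)`-hypergraph, whence the data of
`exists_linkFun_chain`. (The construction needs only `D ≥ 3`; Prop. 14.2 is stated for even `D ≥ 4`.)
[cite: IkenmeyerKandasamy2019, Prop. 14.2] -/
theorem exists_linkFun {D K b : ℕ} (hD : 3 ≤ D) (hK : K ≠ 0) (hlo : K ≤ b * (D - 2))
    (hhi : b * (D - 2) ≤ K + (D - 3)) :
    ∃ (ℓ : Fin b × Fin D → Fin (b + K)) (ζ ξ : Fin b × Fin D),
      (∀ a, 1 ≤ (univ.filter fun v => ℓ v = a).card ∧ (univ.filter fun v => ℓ v = a).card < D) ∧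
      (∀ v w, Relation.ReflTransGen (fun v w : Fin b × Fin D => v.1 = w.1 ∨ ℓ v = ℓ w) v w) ∧
      ζ ≠ ξ ∧ ζ.1 = ξ.1 ∧ ℓ ζ = ℓ ξ := by
  have hb : 1 ≤ b := by
    rcases Nat.eq_zero_or_pos b with rfl | h
    · rw [zero_mul] at hlo
      omega
    · exact h
  have h1 : 2 ≤ b * (D - 2) + 2 - K := by generalize b * (D - 2) = M at hlo hhi ⊢; omega
  have h2 : b * (D - 2) + 2 - K + 1 ≤ D := by generalize b * (D - 2) = M at hlo hhi ⊢; omega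
  have h3 : K + (b * (D - 2) + 2 - K) + 1 = b * (D - 2) + 3 := by
    generalize b * (D - 2) = M at hlo hhi ⊢; omega
  have hH := Chain.isDK_hyper (L₁ := b * (D - 2) + 2 - K) (L₂ := 1) hb hD h1 h2 le_rfl (by omega)
    (fun _ => by omega) h3
  obtain ⟨ℓ, ξ, h⟩ := exists_linkFun_chain hH
  exact ⟨ℓ, _, ξ, h⟩

/-- **"For each `i ∈ I` let `H^{(i)}` be a `(D, ϱ_i)`-hypergraph from Proposition 14.2"** (§15, first
sentence, TeX L1729–1731) together with "Let `h` denote the smallest number in `I`" (TeX L1805): for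
even `D ≥ 3` and any `h ∈ I` the data `IK2020.LinkData m D (blockCount D ∘ ϱ) ϱ` exists, with
`n_i = ⌈ϱ_i/(D-2)⌉` block edges for the letter `i`. [cite: IkenmeyerKandasamy2019, §15] -/
theorem nonempty_linkData {m D : ℕ} (hD : 3 ≤ D) (hDe : Even D) (ρ : Fin m → ℕ) (h₀ : Fin m)
    (hh₀ : ρ h₀ ≠ 0) : Nonempty (LinkData m D (fun i => blockCount D (ρ i)) ρ) := by
  classical
  have hc : 1 ≤ D - 2 := by omega
  have H : ∀ i : Fin m, ρ i ≠ 0 →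
      ∃ (ℓ : Fin (blockCount D (ρ i)) × Fin D → Fin (blockCount D (ρ i) + ρ i))
        (ζ ξ : Fin (blockCount D (ρ i)) × Fin D),
        (∀ a, 1 ≤ (univ.filter fun v => ℓ v = a).card ∧ (univ.filter fun v => ℓ v = a).card < D) ∧
        (∀ v w, Relation.ReflTransGen
          (fun v w : Fin (blockCount D (ρ i)) × Fin D => v.1 = w.1 ∨ ℓ v = ℓ w) v w) ∧
        ζ ≠ ξ ∧ ζ.1 = ξ.1 ∧ ℓ ζ = ℓ ξ := by
    intro i hi
    obtain ⟨hlo, hhi⟩ := ceilDiv_mul_ge_and_le (ρ i) (D - 2) hc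
    refine exists_linkFun hD hi ?_ ?_
    · rw [blockCount_of_even hDe]
      exact hlo
    · rw [blockCount_of_even hDe]
      omega
  choose ℓ ζ ξ hℓ using H
  have hzero : ∀ i, ρ i = 0 → blockCount D (ρ i) = 0 := fun i hi => by
    rw [hi, blockCount_zero]
  have hempty : ∀ i, ρ i = 0 → ∀ v : Fin (blockCount D (ρ i)) × Fin D, False := by
    intro i hi v
    have h : (v.1 : ℕ) < blockCount D (ρ i) := v.1.isLt
    have h0 := hzero i hi
    omega
  have hemptyA : ∀ i, ρ i = 0 → ∀ a : Fin (blockCount D (ρ i) + ρ i), False := by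
    intro i hi a
    have h : (a : ℕ) < blockCount D (ρ i) + ρ i := a.isLt
    have h0 := hzero i hi
    omega
  refine ⟨{
    ℓ := fun i => if hi : ρ i ≠ 0 then ℓ i hi else fun v => Fin.castAdd (ρ i) v.1
    ζ := ζ
    ξ := ξ
    n_eq_zero := hzero
    one_le_card := fun i a => ?_
    card_lt := fun i a => ?_
    conn := fun i v w => ?_
    ζ_ne_ξ := fun i hi => (hℓ i hi).2.2.1
    fst_ζ := fun i hi => (hℓ i hi).2.2.2.1
    ℓ_ζ := fun i hi => ?_
    h₀ := h₀
    ρ_h₀ := hh₀ }⟩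
  · by_cases hi : ρ i ≠ 0
    · simp only [dif_pos hi]
      exact ((hℓ i hi).1 a).1
    · exact (hemptyA i (not_not.mp hi) a).elim
  · by_cases hi : ρ i ≠ 0
    · simp only [dif_pos hi]
      exact ((hℓ i hi).1 a).2
    · exact (hemptyA i (not_not.mp hi) a).elim
  · by_cases hi : ρ i ≠ 0
    · simp only [dif_pos hi]
      exact (hℓ i hi).2.1 v w
    · exact (hempty i (not_not.mp hi) v).elim
  · simp only [dif_pos hi]
    exact (hℓ i hi).2.2.2.2

/-! ## §B  Assembly of a lifting witness from the data -/

namespace LinkData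

variable {m D : ℕ} {n ρ : Fin m → ℕ} (X : LinkData m D n ρ)

/-- The content of `leftpart(T)` does not depend on the enumeration of its columns.
[cite: IkenmeyerKandasamy2019, §15] -/
theorem count_rectTableau_leftpart {E : ℕ} (ε : Fin E ≃ LCol m D n) (u : LiftSym m n ρ) :
    (rectTableau fun c r => X.leftpart (ε c) r).count u =
      ∑ c, (univ.filter fun r => X.leftpart c r = u).card := by
  rw [count_rectTableau]
  exact Equiv.sum_comp ε (fun c => (univ.filter fun r => X.leftpart c r = u).card)

/-- Reindexing a finite filter along a bijection. [folklore] -/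
private theorem card_filter_comp_equiv {α β : Type*} [Fintype α] [Fintype β] (e : α ≃ β)
    (P : β → Prop) [DecidablePred P] :
    (univ.filter fun a => P (e a)).card = (univ.filter P).card := by
  have h : (univ.filter fun a => P (e a)) = (univ.filter P).map e.symm.toEmbedding := by
    ext a
    simp only [Finset.mem_filter, Finset.mem_univ, true_and, Finset.mem_map_equiv,
      Equiv.symm_symm]
  rw [h, Finset.card_map]

/-- **The lifted tableau is a lifting witness** (§17, TeX L2080–2400, for even `D`): `T = leftpart(T)
+ rightpart(T)` with `leftpart(T) = B̌` (columns enumerated by any `Fin E ≃ LCol`) and `rightpart(T)`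
chosen with the quotas `D - n(i_ℓ)` of §16 satisfies: every symbol occurs exactly `D` times (Claims
25, 26, 28 and eq. (16.3)); for every `φ` with `φ(T)` regular, `rightpart(φ(T)) ∈ 𝔖_m S` (Claims 29,
30) and `leftpart(φ(T))` is duplex (properties (I)–(III), `D` even); and `φ(i_ℓ) = i`, `φ(j_k^i) = j`
makes `φ(T)` regular with `rightpart(φ(T)) = S`. [cite: IkenmeyerKandasamy2019, Thm. 13.1] -/
theorem exists_liftingWitness (hD : Even D) (S : ColTableau (Fin m)) (hreg : S.IsRegular)
    (hcnt : ∀ i, S.count i = D * ρ i) {E : ℕ} (ε : Fin E ≃ LCol m D n) :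
    ∃ R : (c : Fin S.C) → Fin (S.h c) → LiftSym m n ρ,
      LiftingWitness D S (fun c r => X.leftpart (ε c) r) R := by
  classical
  -- `rightpart(T)` with the quotas `D - n(i_ℓ)` (§16; they add up by Claim 26)
  obtain ⟨R, hR1, hR2, hR3⟩ := exists_rightpart S
    (fun x : (Σ i : Fin m, Fin (n i + ρ i)) => D - (univ.filter fun v => X.ℓ x.1 v = x.2).card)
    (fun i => by rw [X.sum_sub_card_fibre, hcnt])
  refine ⟨R, fun u => ?_, fun φ hL hRφ => ?_, ?_⟩
  · -- (count): every symbol occurs exactly `D` times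
    rw [X.count_rectTableau_leftpart ε]
    rcases LiftSym.eq_name_or_eq_block u with ⟨i, a, rfl⟩ | ⟨i, k, j, hj, rfl⟩
    · rw [X.lcount_name, hR2]
      exact Nat.add_sub_cancel' (X.card_lt i a).le
    · rw [X.lcount_block, show (ColTableau.mk S.C S.h R).count (LiftSym.block i k j hj) = 0
        from hR3 _, Nat.add_zero]
  · -- parts (1) and (2)
    have hreg' : ∀ c, Function.Injective fun r => φ (X.leftpart c r) := fun c => by
      have h := hL (ε.symm c)
      simp only [rectTableau, Equiv.apply_symm_apply] at h
      exact h
    refine ⟨exists_perm_relabel_eq_of_name_const' S hR1 hcnt φ (X.phi0 φ) (X.phi_name hreg')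
      (X.phi0_injOn hreg'), ?_⟩
    rw [isDuplex_rectTableau_iff]
    intro c
    have h := X.even_card_filter_leftpart hD hreg' (ε c)
    rw [← card_filter_comp_equiv ε] at h
    convert h using 2
  · -- part (3): `φ(i_ℓ) = i`, `φ(j_k^i) = j`
    exact ⟨LiftSym.base, fun c => X.injective_base_leftpart (ε c),
      isRegular_relabel_base S hR1 hreg, relabel_base_eq S hR1⟩

end LinkData

/-! ## §C  Thm. 13.1 for even `D` -/

/-- The number of columns of `leftpart(T)`: `e_ϱ D = ∑_i n_i D` is the number of vertices of all the
hypergraphs (§15: "the number of columns in `leftpart(T)` is equal to the total number of vertices in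
the hypergraphs `H^{(i)}`, `i ∈ I`"). [cite: IkenmeyerKandasamy2019, §15] -/
theorem card_lCol_blockCount {m : ℕ} (D : ℕ) (ρ : Fin m → ℕ) :
    Fintype.card (LCol m D fun i => blockCount D (ρ i)) = eRho D (Finset.univ.val.map ρ) * D := by
  rw [eRho_map_eq_sum, Finset.sum_mul]
  simp [LCol, Fintype.card_sigma, Fintype.card_prod, Fintype.card_fin]

end IK2020

open IK2020

/-- **Ikenmeyer–Kandasamy 2020, Thm. 13.1 (Tableau Lifting Theorem) for even `D`**, over the
descriptive alphabet `i_ℓ`, `j_k^i` of §13 (`IK2020.LiftSym`): for even `D ≥ 3`, `m ≥ 2`, a regular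
tableau `S` of shape `λ ⊢_m dD` and content `Dϱ`, there is a lifted tableau
`T = leftpart(T) + rightpart(T)` with `e_ϱ D` left columns in which every symbol occurs exactly `D`
times and with properties (1), (2), (3) of Thm. 13.1 (`IK2020.LiftingWitness`). Proof = §§14–17 as
formalised in bricks E1 (alphabet), E2 (`leftpart`), E3 (`rightpart`), E2h (hypergraph data from the
chain construction of Prop. 14.2) and the corner `d = 0` (empty alphabet).
[cite: IkenmeyerKandasamy2019, Thm. 13.1] -/
theorem IK2020_thm_13_1_even (D m d : ℕ) (hDe : Even D) (hD : 3 ≤ D) (hm : 2 ≤ m)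
    (S : ColTableau (Fin m)) (hS : S.IsShape m (d * D)) (hreg : S.IsRegular)
    (ρ : Fin m → ℕ) (hsum : ∑ i, ρ i = d) (hcnt : ∀ i, S.count i = D * ρ i) :
    ∃ (L : Fin (eRho D (Finset.univ.val.map ρ) * D) → Fin m →
        LiftSym m (fun i => blockCount D (ρ i)) ρ)
      (R : (c : Fin S.C) → Fin (S.h c) → LiftSym m (fun i => blockCount D (ρ i)) ρ),
      LiftingWitness D S L R := by
  classical
  by_cases hd : d = 0
  · -- the corner `d = 0`: `S` is empty, `e_ϱ = 0`, the alphabet is empty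
    subst hd
    have hρ : ∀ i, ρ i = 0 := fun i => by
      have := Finset.single_le_sum (fun j _ => Nat.zero_le (ρ j)) (Finset.mem_univ i)
      omega
    have he : eRho D (Finset.univ.val.map ρ) = 0 := by
      rw [eRho_map_eq_sum]
      exact Finset.sum_eq_zero fun i _ => by rw [hρ i, blockCount_zero]
    have hC : S.C = 0 := ColTableau.C_eq_zero_of_isShape_zero (by simpa using hS)
    have hE : eRho D (Finset.univ.val.map ρ) * D = 0 := by rw [he, zero_mul]
    haveI : IsEmpty (LiftSym m (fun i => blockCount D (ρ i)) ρ) := by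
      rw [← Fintype.card_eq_zero_iff, card_liftSym_blockCount D ρ hsum, he, mul_zero]
    exact ⟨fun c => (Fin.cast hE c).elim0, fun c => (Fin.cast hC c).elim0,
      LiftingWitness.of_isEmpty (by omega) hC _ _⟩
  · -- `d ≠ 0`: `I` is nonempty; pick `h ∈ I` and the hypergraph data
    obtain ⟨h₀, hh₀⟩ : ∃ i, ρ i ≠ 0 := by
      by_contra h
      simp only [not_exists, not_not] at h
      exact hd (by rw [← hsum]; exact Finset.sum_eq_zero fun i _ => h i)
    obtain ⟨X⟩ := nonempty_linkData hD hDe ρ h₀ hh₀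
    let ε : Fin (eRho D (Finset.univ.val.map ρ) * D) ≃ LCol m D (fun i => blockCount D (ρ i)) :=
      (Fintype.equivFinOfCardEq (card_lCol_blockCount D ρ)).symm
    obtain ⟨R, hW⟩ := X.exists_liftingWitness hDe S hreg hcnt ε
    exact ⟨_, R, hW⟩

/-- **Thm. 13.1 for even `D`, verbatim over the alphabet `{1, …, δ}`** (`δ = m e_ϱ + d`): the body
of the named fact `IK2020_thm_13_1` under the extra hypothesis `Even D` (the hypotheses `Antitone ϱ`
and, vacuously, the odd-`D` binomial condition of the fact are not needed). The passage from the
descriptive alphabet is `LiftingWitness.exists_fin` (§13, chunk p0020.txt:L22).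
[cite: IkenmeyerKandasamy2019, Thm. 13.1] -/
theorem IK2020_thm_13_1_of_even (D m d : ℕ) (hDe : Even D) (hD : 3 ≤ D) (hm : 2 ≤ m)
    (S : ColTableau (Fin m)) (hS : S.IsShape m (d * D)) (hreg : S.IsRegular)
    (ρ : Fin m → ℕ) (hsum : ∑ i, ρ i = d) (hcnt : ∀ i, S.count i = D * ρ i) :
    ∃ (L : Fin (eRho D (Finset.univ.val.map ρ) * D) → Fin m →
        Fin (m * eRho D (Finset.univ.val.map ρ) + d))
      (R : (c : Fin S.C) → Fin (S.h c) → Fin (m * eRho D (Finset.univ.val.map ρ) + d)),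
      LiftingWitness D S L R := by
  obtain ⟨L, R, hW⟩ := IK2020_thm_13_1_even D m d hDe hD hm S hS hreg ρ hsum hcnt
  exact hW.exists_fin (card_liftSym_blockCount D ρ hsum)

/-- **What remains of `IK2020_thm_13_1`: its odd-`D` half** (§§18–21, TeX L2410–3500). The named fact
follows from lifting witnesses over the descriptive alphabet for odd `D ≥ 3` under the binomial
condition `C(2(D-1), D-1) ≥ 2(m-1)`; the even half is `IK2020_thm_13_1_even`.
[cite: IkenmeyerKandasamy2019, Thm. 13.1] -/
theorem IK2020_thm_13_1_of_odd_case
    (H : ∀ (D m d : ℕ), Odd D → 3 ≤ D → 2 ≤ m → 2 * (m - 1) ≤ Nat.choose (2 * (D - 1)) (D - 1) →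
      ∀ (S : ColTableau (Fin m)), S.IsShape m (d * D) → S.IsRegular →
      ∀ (ρ : Fin m → ℕ), Antitone ρ → ∑ i, ρ i = d → (∀ i, S.count i = D * ρ i) →
        ∃ (L : Fin (eRho D (Finset.univ.val.map ρ) * D) → Fin m →
            LiftSym m (fun i => blockCount D (ρ i)) ρ)
          (R : (c : Fin S.C) → Fin (S.h c) → LiftSym m (fun i => blockCount D (ρ i)) ρ),
          LiftingWitness D S L R) :
    IK2020_thm_13_1 :=
  IK2020_thm_13_1_of_forall_exists_liftSym_witness fun D m d hD hm hodd S hS hreg ρ hρ hsum hcnt =>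
    (Nat.even_or_odd D).elim (fun he => IK2020_thm_13_1_even D m d he hD hm S hS hreg ρ hsum hcnt)
      fun ho => H D m d ho hD hm (hodd ho) S hS hreg ρ hρ hsum hcnt

end Literature.Computability.AlgebraicComplexity
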